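import Summits.ResolutionOfSingularities.ResolutionOfSingularities.Theorems.PurelyInseparableDim4AtlasChildAdmissibleFibre
import Summits.ResolutionOfSingularities.ResolutionOfSingularities.Theorems.PurelyInseparableDim4AtlasChildPieces
import Summits.ResolutionOfSingularities.ResolutionOfSingularities.Theorems.PurelyInseparableDim4AtlasChildReadings
import Summits.ResolutionOfSingularities.ResolutionOfSingularities.Theorems.PurelyInseparableDim4AtlasMemberChartsL
import Summits.ResolutionOfSingularities.ResolutionOfSingularities.Theorems.PurelyInseparableDim4AtlasShapeChartMemLetters
import Summits.ResolutionOfSingularities.ResolutionOfSingularities.Theorems.PurelyInseparableDim4AtlasChildModel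
import HarnessLib

/-!
# Purely inseparable four-folds: THE ATLAS CHILD PACKAGE WITH LETTERS (brick S3 (c) v4, tranche 2, brick A1⁺; cell `res-dim4-pi`)

[OURS · counted 0] (D-0157 DOOR 2; host item stmt-ResolutionOfSingularities-16155, helper). Nothing here proves resolution of singularities in
dimension ≥ 4 / characteristic `p`. Tranche-2 twin of A1 `atlas_child_package` (p718147; memo `res-dim4-typ-3/S3c-V4-ATLAS-MEMBERS-DESIGN.md`
§16, E-V4-4): A1's setting plus the parent's LETTERS `L` (every boundary component meeting the parent's region reads through a letter of `L`);
A1's output with `MemberAtlasZL`, the child's readings carrying `mainLetters` / `extraLetters` (DefsFour), via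
`letters_transform_zigzag_of_chart_mem` (p726223) and `memberAtlasZL_of_charts`. Proof = p718147's with the two lemma calls exchanged.
* **`atlas_child_package_L`**. AI-produced formalisation, weaker than expert review. bears_on: LADDER-RESOLUTION:D157-DOOR2 (res-dim4-pi · A1⁺).
-/
set_option linter.dupNamespace false -- D-0017: single-problem summit path `Summit.<S>.<S>.…` by design

noncomputable section

open MvPolynomial Finset CategoryTheory AlgebraicGeometry Opposite TopologicalSpace
open AlgebraicGeometry.Scheme.IdealSheafData (ofIdealTop vanishingIdeal)

namespace Summit.ResolutionOfSingularities.ResolutionOfSingularities.Theorems.PIDim4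

open Literature.AlgebraicGeometry.Resolution
open Literature.AlgebraicGeometry.Resolution.Hauser2010
open Literature.AlgebraicGeometry.Resolution.AffinePointBlowup (P A γ coord Wtop ξ)

namespace Equimultiple

section AtlasChildL

variable {K : Type} [Field K] {p : ℕ} [hp : Fact p.Prime] [CharP K p] [DecidableEq K]
variable {Z Y W Bl : Scheme.{0}} (φ : Y ⟶ Z) [IsOpenImmersion φ] (ψ : Y ⟶ P 4 K) [IsOpenImmersion ψ]
  {π : W ⟶ Z} {B : Bl ⟶ P 4 K} {S : Finset (Fin 4)}
  (ε : (π ⁻¹ᵁ φ.opensRange : Scheme.{0}) ≅ (B ⁻¹ᵁ ψ.opensRange : Scheme.{0}))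

/-- **THE ATLAS CHILD PACKAGE WITH LETTERS (v4 tranche 2 A1⁺).** See the module docstring. [cite: BierstoneGrigorievMilmanWlodarczyk2011, §4 Step 2b; Def. 3.1.3
(1), (2), (4)] [cite: Hauser2010, §G] [cite: StacksProject, Tag 01J7] -/
theorem atlas_child_package_L [IsLocallyNoetherian Z] [IsAlgClosed K] [DecidableEq (AReadingL K)] (Zc : Z.IdealSheafData)
    (hπ : IsBlowup π Zc) (hB : IsBlowup B (AffineCoordBlowup.𝓘Λ 4 K (insert 0 (Fin.succ '' (S : Set (Fin 4))))))
    (hsq : ε.hom ≫ (B ∣_ ψ.opensRange) = (π ∣_ φ.opensRange) ≫ (φ.isoOpensRange.inv ≫ ψ.isoOpensRange.hom))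
    (hC' : ((AffineCoordBlowup.𝓘Λ 4 K (insert 0 (Fin.succ '' (S : Set (Fin 4))))).comap ψ.opensRange.ι).comap
        (φ.isoOpensRange.inv ≫ ψ.isoOpensRange.hom) = Zc.comap φ.opensRange.ι)
    (M : MarkedIdeal Z) (hmult : M.mult = p) (s : State K) (hF : s.F ≠ 0)
    (hclean : Literature.Barriers.ResolutionOfSingularities.HauserPerlega.IsClean p s.F)
    (hKEY : ((controlledTransform B (AffineCoordBlowup.𝓘Λ 4 K (insert 0 (Fin.succ '' (S : Set (Fin 4)))))
        (hypSheaf p s.F) p).comap (B ⁻¹ᵁ ψ.opensRange).ι).comap ε.hom =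
      (controlledTransform π Zc M.ideal p).comap (π ⁻¹ᵁ φ.opensRange).ι)
    (hperm : (p : ℕ∞) ≤ CentreBlowup.ordAlong S s.F)
    (hsee : (AffineCoordBlowup.CΛ 4 K (insert 0 (Fin.succ '' (S : Set (Fin 4)))) : Set (P 4 K)) ⊆ Set.range ψ)
    (hsncZ : HasSNCWith M.boundary Zc) (idx : Z.IdealSheafData → Fin 4) (cst : Z.IdealSheafData → K)
    (hshape : ∀ D ∈ M.boundary, ((D.support : Set Z) ∩ φ '' (ψ ⁻¹'
        (AffineCoordBlowup.CΛ 4 K (insert 0 (Fin.succ '' (S : Set (Fin 4)))) : Set (P 4 K)))).Nonempty →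
      D.comap φ = (ofIdealTop (Ideal.span {(γ 4 K).symm (X (idx D).succ + C (cst D))})).comap ψ ∧ (idx D ∈ S → cst D = 0))
    (hinj : ∀ D₁ ∈ M.boundary, ∀ D₂ ∈ M.boundary,
      ((D₁.support : Set Z) ∩ φ '' (ψ ⁻¹' (AffineCoordBlowup.CΛ 4 K (insert 0 (Fin.succ '' (S : Set (Fin 4)))) : Set (P 4 K)))).Nonempty →
      ((D₂.support : Set Z) ∩ φ '' (ψ ⁻¹' (AffineCoordBlowup.CΛ 4 K (insert 0 (Fin.succ '' (S : Set (Fin 4)))) : Set (P 4 K)))).Nonempty →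
      idx D₁ = idx D₂ → D₁ = D₂) (L : Finset (Fin 4 × K))
    (hL : ∀ D ∈ M.boundary, ((D.support : Set Z) ∩ φ '' (ψ ⁻¹'
        (AffineCoordBlowup.CΛ 4 K (insert 0 (Fin.succ '' (S : Set (Fin 4)))) : Set (P 4 K)))).Nonempty → (idx D, cst D) ∈ L)
    (Xd : Finset (Fin 4 × K)) (Dd : Finset (Fin 4))
    {j : Fin 4} (hj : j ∈ S) {b : Fin 4 → K} (hbj : b j = 0) {S'' : Finset (Fin 4)} (hjS'' : j ∈ S'')
    (hbE : ¬ S ⊆ S'' → ∀ i ∈ S, b i = 0)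
    (hDd : ∀ m ∈ Dd, m ∈ S'' ∧ m ∉ S) (hXd : ∀ iv ∈ Xd, iv.1 ∈ Dd)
    (hfib : IsClosed (φ '' (ψ ⁻¹' ownedSetZ S (Dd.image fun m => (m, b m)))))
    (hperm' : (p : ℕ∞) ≤ CentreBlowup.ordAlong S'' (CentreBlowup.step p S j b s).F) :
    ∃ (c'' : Closeds W) (Θ : Fin 4 → (A 4 K ≃ₐ[K] A 4 K)),
      (∀ m ∈ insert j (S \ S''), ∀ i : Fin 4, Θ m (X i.succ) = X i.succ + C (b i)) ∧
      (∀ m ∈ insert j (S \ S''), ∃ h : MvPolynomial (Fin 4) K, Θ m (X 0) = X 0 + rename Fin.succ h) ∧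
      (∀ (m : Fin 4) (hmS : m ∈ S), (m = j ∨ m ∉ S'') →
        (controlledTransform B (AffineCoordBlowup.𝓘Λ 4 K (insert 0 (Fin.succ '' (S : Set (Fin 4))))) (hypSheaf p s.F) p).comap
            (Spec.map (CommRingCat.ofHom (Θ m : A 4 K →+* A 4 K)) ≫
              AffineCoordBlowup.chartImm hB (ChartDictionary.succ_mem_centreVars hmS)) =
          hypSheaf p (if m = j then (CentreBlowup.step p S j b s).F else (escState p S m b s).F) ∧
        (p : ℕ∞) ≤ CentreBlowup.ordAlong (if m = j then S'' else insert m (S''.erase j))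
          (if m = j then (CentreBlowup.step p S j b s).F else (escState p S m b s).F)) ∧
      (∀ (w : W) (hwV : w ∈ π ⁻¹ᵁ φ.opensRange), w ∈ (c'' : Set W) ↔
        ∃ (m : Fin 4) (hmS : m ∈ S), (m = j ∨ m ∉ S'') ∧
          ((B ⁻¹ᵁ ψ.opensRange).ι (ε.hom ⟨w, hwV⟩) : Bl) ∈
            (Spec.map (CommRingCat.ofHom (Θ m : A 4 K →+* A 4 K)) ≫
              AffineCoordBlowup.chartImm hB (ChartDictionary.succ_mem_centreVars hmS)) ''
              (AffineCoordBlowup.CΛ 4 K (insert 0 (Fin.succ ''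
                ((if m = j then S'' else insert m (S''.erase j) : Finset (Fin 4)) : Set (Fin 4)))) : Set (P 4 K))) ∧
      (∀ (m : Fin 4) (hmS : m ∈ S), (m = j ∨ m ∉ S'') → ∀ (m' : Fin 4) (hm'S : m' ∈ S), (m' = j ∨ m' ∉ S'') →
        (Spec.map (CommRingCat.ofHom (Θ m : A 4 K →+* A 4 K)) ≫
            AffineCoordBlowup.chartImm hB (ChartDictionary.succ_mem_centreVars hmS)) ''
            (AffineCoordBlowup.CΛ 4 K (insert 0 (Fin.succ ''
              ((if m = j then S'' else insert m (S''.erase j) : Finset (Fin 4)) : Set (Fin 4)))) : Set (P 4 K)) ∩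
          Set.range (AffineCoordBlowup.chartImm hB (ChartDictionary.succ_mem_centreVars hm'S)) ⊆
        (Spec.map (CommRingCat.ofHom (Θ m' : A 4 K →+* A 4 K)) ≫
            AffineCoordBlowup.chartImm hB (ChartDictionary.succ_mem_centreVars hm'S)) ''
            (AffineCoordBlowup.CΛ 4 K (insert 0 (Fin.succ ''
              ((if m' = j then S'' else insert m' (S''.erase j) : Finset (Fin 4)) : Set (Fin 4)))) : Set (P 4 K))) ∧
      (c'' : Set W) ⊆ π ⁻¹' (φ '' (ψ ⁻¹' ownedSetZ S ((S'' \ S).image fun m => (m, b m)))) ∧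
      (c'' : Set W).Nonempty ∧
      Scheme.IsRegular (vanishingIdeal c'').subscheme ∧
      HasSNCWith (M.transform π Zc).boundary (vanishingIdeal c'') ∧
      MemberAtlasZL p (M.transform π Zc) c''
        (insert (mainReading p (s, S, Xd, Dd) (j, b, S''), mainLetters (j, b, S'') L)
          ((S \ S'').image fun l => (extraReading p (s, S, Xd, Dd) (j, b, S'') l, extraLetters (j, b, S'') l L))) := by
  classical
  haveI : IsProper π := hπ.isProper
  haveI : IsLocallyNoetherian W := LocallyOfFiniteType.isLocallyNoetherian π
  haveI : IsProper B := hB.isProper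
  haveI : IsLocallyNoetherian Bl := LocallyOfFiniteType.isLocallyNoetherian B
  obtain ⟨Θ, hΘS, hΘ0S, hchartS, hcovS⟩ := atlas_child_model (p := p) hB s hF hclean hperm hj hbj hjS'' hbE hperm'
  set Pc : Finset (Fin 4) := insert j (S \ S'') with hPc_def
  have hPc : ∀ m ∈ Pc, m ∈ S := fun m hm => by
    rcases Finset.mem_insert.mp hm with rfl | hm
    · exact hj
    · exact (Finset.mem_sdiff.mp hm).1
  have hne_j : ∀ m ∈ Pc, m ≠ j → m ∈ S ∧ m ∉ S'' := fun m hm hmj => by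
    rcases Finset.mem_insert.mp hm with h | h
    · exact absurd h hmj
    · exact Finset.mem_sdiff.mp h
  have hjSS : j ∉ S \ S'' := fun h => (Finset.mem_sdiff.mp h).2 hjS''
  have hbP : ∀ m ∈ Pc, b m = 0 := fun m hm => by
    by_cases hmj : m = j
    · rw [hmj]; exact hbj
    · obtain ⟨hmS, hmS''⟩ := hne_j m hm hmj
      exact hbE (fun h => hmS'' (h hmS)) m hmS
  have hPcj : ∀ m ∈ Pc, m = j ∨ m ∉ S'' := fun m hm => by
    by_cases hmj : m = j
    · exact Or.inl hmj
    · exact Or.inr (hne_j m hm hmj).2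
  have hΘall : ∀ m ∈ Pc, ∀ i : Fin 4, Θ m (X i.succ) = X i.succ + C (b i) := fun m hm => hΘS m (hPc m hm) (hPcj m hm)
  have hΘ0all : ∀ m ∈ Pc, ∃ h : MvPolynomial (Fin 4) K, Θ m (X 0) = X 0 + rename Fin.succ h :=
    fun m hm => hΘ0S m (hPc m hm) (hPcj m hm)
  have hPc_of : ∀ m, m ∈ S → (m = j ∨ m ∉ S'') → m ∈ Pc := fun m hmS hmj => by
    rcases hmj with rfl | hmS''
    · exact Finset.mem_insert_self _ _
    · exact Finset.mem_insert_of_mem (Finset.mem_sdiff.mpr ⟨hmS, hmS''⟩)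
  have hΘfix : ∀ m ∈ Pc, ∀ m' ∈ Pc, Θ m (X m'.succ) = X m'.succ := fun m hm m' hm' => by
    rw [hΘall m hm m', hbP m' hm', C_0, add_zero]
  let rd : Fin 4 → AReading K := fun m =>
    if m = j then mainReading p (s, S, Xd, Dd) (j, b, S'') else extraReading p (s, S, Xd, Dd) (j, b, S'') m
  have hrdj : rd j = mainReading p (s, S, Xd, Dd) (j, b, S'') := if_pos rfl
  have hrdl : ∀ m, m ≠ j → rd m = extraReading p (s, S, Xd, Dd) (j, b, S'') m := fun m hmj => if_neg hmj
  have hT : ∀ m, (rd m).2.1 = if m = j then S'' else insert m (S''.erase j) := fun m => by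
    by_cases hmj : m = j
    · rw [if_pos hmj, hmj, hrdj]; exact (childReading_main p s S Xd Dd j b S'').1
    · rw [if_neg hmj, hrdl m hmj]; exact (childReading_extra p s S Xd Dd j b S'' m).1
  have hFm : ∀ m, (rd m).1.F = if m = j then (CentreBlowup.step p S j b s).F else (escState p S m b s).F := fun m => by
    by_cases hmj : m = j
    · rw [if_pos hmj, hmj, hrdj, (childReading_main p s S Xd Dd j b S'').2.1]
    · rw [if_neg hmj, hrdl m hmj, (childReading_extra p s S Xd Dd j b S'' m).2.1]
  have hDir : ∀ m ∈ Pc, (rd m).2.2.2 = Pc.erase m := fun m hm => by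
    by_cases hmj : m = j
    · rw [hmj, hrdj, (childReading_main p s S Xd Dd j b S'').2.2, hPc_def, Finset.erase_insert hjSS]
    · rw [hrdl m hmj, (childReading_extra p s S Xd Dd j b S'' m).2.2]
  have hTm : ∀ m ∈ Pc, m ∈ (rd m).2.1 := fun m hm => by
    rw [hT]
    by_cases hmj : m = j
    · rw [if_pos hmj, hmj]; exact hjS''
    · rw [if_neg hmj]; exact Finset.mem_insert_self _ _
  have hfree : ∀ i, i ∈ S'' → i ∉ S → ∀ m ∈ Pc, i ∈ (rd m).2.1 := fun i hiS'' hiS m hm => by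
    rw [hT]
    by_cases hmj : m = j
    · rw [if_pos hmj]; exact hiS''
    · rw [if_neg hmj]; exact Finset.mem_insert_of_mem (Finset.mem_erase.mpr ⟨fun h => hiS (h ▸ hj), hiS''⟩)
  have hDT : ∀ i ∈ Dd, i ∉ S ∧ ∀ m ∈ Pc, i ∈ (rd m).2.1 := fun i hi => ⟨(hDd i hi).2, hfree i (hDd i hi).1 (hDd i hi).2⟩
  have hDS : ∀ i ∈ S'' \ S, i ∉ S ∧ ∀ m ∈ Pc, i ∈ (rd m).2.1 := fun i hi =>
    ⟨(Finset.mem_sdiff.mp hi).2, hfree i (Finset.mem_sdiff.mp hi).1 (Finset.mem_sdiff.mp hi).2⟩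
  have hST : ∀ m ∈ Pc, S.erase m ⊆ (rd m).2.1 ∪ Pc.erase m := fun m hm i hi => by
    obtain ⟨him, hiS⟩ := Finset.mem_erase.mp hi
    rw [hT, Finset.mem_union]
    by_cases hiS'' : i ∈ S''
    · by_cases hmj : m = j
      · rw [if_pos hmj]; exact Or.inl hiS''
      · by_cases hij : i = j
        · exact Or.inr (Finset.mem_erase.mpr ⟨him, hij ▸ Finset.mem_insert_self _ _⟩)
        · rw [if_neg hmj]; exact Or.inl (Finset.mem_insert_of_mem (Finset.mem_erase.mpr ⟨hij, hiS''⟩))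
    · exact Or.inr (Finset.mem_erase.mpr ⟨him, Finset.mem_insert_of_mem (Finset.mem_sdiff.mpr ⟨hiS, hiS''⟩)⟩)
  have hPT : ∀ m ∈ Pc, ∀ i ∈ Pc, i ≠ m → i ∉ (rd m).2.1 := fun m hm i hi him => by
    rw [hT]
    by_cases hmj : m = j
    · rw [if_pos hmj]
      exact (hne_j i hi (hmj ▸ him)).2
    · rw [if_neg hmj, Finset.mem_insert, not_or]
      refine ⟨him, fun h => ?_⟩
      obtain ⟨hij, hiS''⟩ := Finset.mem_erase.mp h
      exact (hne_j i hi hij).2 hiS''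
  set Zm : Bl.IdealSheafData := vanishingIdeal (closureImage
      (Spec.map (CommRingCat.ofHom (Θ j : A 4 K →+* A 4 K)) ≫ AffineCoordBlowup.chartImm hB (ChartDictionary.succ_mem_centreVars hj))
      ((AffineCoordBlowup.𝓘Λ 4 K (insert 0 (Fin.succ '' (S'' : Set (Fin 4))))).support : Set (P 4 K))) with hZm
  have hZread : ∀ m (hm : m ∈ Pc),
      Zm.comap (Spec.map (CommRingCat.ofHom (Θ m : A 4 K →+* A 4 K)) ≫
        AffineCoordBlowup.chartImm hB (ChartDictionary.succ_mem_centreVars (hPc m hm))) =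
      AffineCoordBlowup.𝓘Λ 4 K (insert 0 (Fin.succ '' ((rd m).2.1 : Set (Fin 4)))) := by
    intro m hm
    rw [hT]
    exact (hchartS m (hPc m hm) (hPcj m hm)).1
  have hMread : ∀ m (hm : m ∈ Pc),
      (controlledTransform B (AffineCoordBlowup.𝓘Λ 4 K (insert 0 (Fin.succ '' (S : Set (Fin 4))))) (hypSheaf p s.F) p).comap
        (Spec.map (CommRingCat.ofHom (Θ m : A 4 K →+* A 4 K)) ≫
          AffineCoordBlowup.chartImm hB (ChartDictionary.succ_mem_centreVars (hPc m hm))) = hypSheaf p (rd m).1.F := by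
    intro m hm
    rw [hFm]
    exact (hchartS m (hPc m hm) (hPcj m hm)).2.1
  have hcov' : (Zm.support : Set Bl) ⊆ ⋃ (m : Fin 4) (hm : m ∈ Pc),
      Set.range (Spec.map (CommRingCat.ofHom (Θ m : A 4 K →+* A 4 K)) ≫
        AffineCoordBlowup.chartImm hB (ChartDictionary.succ_mem_centreVars (hPc m hm))) := by
    intro z hz
    obtain ⟨m, hzm⟩ := Set.mem_iUnion.mp (hcovS hz)
    obtain ⟨hmS, hzm⟩ := Set.mem_iUnion.mp hzm
    obtain ⟨hmj, hzm⟩ := Set.mem_iUnion.mp hzm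
    exact Set.mem_iUnion₂.mpr ⟨m, hPc_of m hmS hmj, hzm⟩
  have hZ : ∀ m (hm : m ∈ Pc), (Zm.support : Set Bl) ∩
      Set.range (Spec.map (CommRingCat.ofHom (Θ m : A 4 K →+* A 4 K)) ≫
        AffineCoordBlowup.chartImm hB (ChartDictionary.succ_mem_centreVars (hPc m hm))) ⊆
      (Spec.map (CommRingCat.ofHom (Θ m : A 4 K →+* A 4 K)) ≫
        AffineCoordBlowup.chartImm hB (ChartDictionary.succ_mem_centreVars (hPc m hm))) ''
        (AffineCoordBlowup.CΛ 4 K (insert 0 (Fin.succ '' ((rd m).2.1 : Set (Fin 4)))) : Set (P 4 K)) := by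
    rintro m hm z ⟨hz, y, rfl⟩
    refine ⟨y, ?_, rfl⟩
    have h1 : y ∈ (Zm.comap (Spec.map (CommRingCat.ofHom (Θ m : A 4 K →+* A 4 K)) ≫
        AffineCoordBlowup.chartImm hB (ChartDictionary.succ_mem_centreVars (hPc m hm)))).support := by
      rw [Scheme.IdealSheafData.support_comap]; exact hz
    rw [hZread m hm, AffineCoordBlowup.support_𝓘Λ] at h1
    exact h1
  have hmemZ : ∀ m (hm : m ∈ Pc) (y : P 4 K),
      y ∈ (AffineCoordBlowup.CΛ 4 K (insert 0 (Fin.succ '' ((rd m).2.1 : Set (Fin 4)))) : Set (P 4 K)) →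
      (Spec.map (CommRingCat.ofHom (Θ m : A 4 K →+* A 4 K)) ≫
        AffineCoordBlowup.chartImm hB (ChartDictionary.succ_mem_centreVars (hPc m hm))) y ∈ (Zm.support : Set Bl) := by
    intro m hm y hy
    have h1 : y ∈ ((Zm.comap (Spec.map (CommRingCat.ofHom (Θ m : A 4 K →+* A 4 K)) ≫
        AffineCoordBlowup.chartImm hB (ChartDictionary.succ_mem_centreVars (hPc m hm)))).support : Set (P 4 K)) := by
      rw [hZread m hm, AffineCoordBlowup.support_𝓘Λ]; exact hy
    rw [Scheme.IdealSheafData.support_comap] at h1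
    exact h1
  have hfib' : IsClosed (φ '' (ψ ⁻¹' {x : P 4 K | x ∈ (AffineCoordBlowup.CΛ 4 K (insert 0 (Fin.succ '' (S : Set (Fin 4)))) : Set (P 4 K)) ∧
      ∀ i ∈ Dd, (X i.succ - C (b i) : A 4 K) ∈ x.asIdeal})) := by
    rw [ownedSetZ_image_eq] at hfib
    exact hfib
  obtain ⟨c'', hmemε, hover, hne, hcovW, hread⟩ :=
    atlas_child_of_charts' φ ψ ε Zc hB hsq hC' M hmult s.F hKEY hsee Pc hPc ⟨j, Finset.mem_insert_self _ _⟩ Θ hΘall hbP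
      (fun m => (rd m).2.1) hTm Dd hDT hfib' Zm (fun m => (rd m).1.F) hZread hMread hcov'
  obtain ⟨hreg, hsnc⟩ :=
    isRegular_and_hasSNCWith_of_chart_readings' φ ψ ε Zc hπ hB hsq hC' M hsncZ idx cst hshape hinj Pc hPc Θ hΘall hbP
      (fun m => (rd m).2.1) hTm c'' hcovW (fun m hm => (hread m hm).2.1)
  have hcV : (c'' : Set W) ⊆ ((π ⁻¹ᵁ φ.opensRange : W.Opens) : Set W) := by
    intro w hw
    obtain ⟨y, -, hy⟩ := hover hw
    exact ⟨y, hy⟩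
  let rk : Fin 4 → ℕ := fun m => if m = j then 0 else m.val + 1
  have hrk : Set.InjOn rk Pc := by
    intro m hm m' hm' h
    by_cases hmj : m = j <;> by_cases hm'j : m' = j
    · rw [hmj, hm'j]
    · exfalso; simp only [rk, if_pos hmj, if_neg hm'j] at h; exact Nat.succ_ne_zero _ h.symm
    · exfalso; simp only [rk, if_neg hmj, if_pos hm'j] at h; exact Nat.succ_ne_zero _ h
    · simp only [rk, if_neg hmj, if_neg hm'j, Nat.add_right_cancel_iff] at h
      exact Fin.ext h
  have hpiece : ∀ m ∈ Pc, ownedSetZ (rd m).2.1 (rd m).2.2.1 =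
      (AffineCoordBlowup.CΛ 4 K (insert 0 (Fin.succ '' ((rd m).2.1 : Set (Fin 4)))) : Set (P 4 K)) ∩
        {y : P 4 K | ∀ m' ∈ Pc, rk m' < rk m → (X m'.succ : A 4 K) ∈ y.asIdeal} := by
    intro m hm
    by_cases hmj : m = j
    · subst hmj
      rw [hrdj, (childReading_main p s S Xd Dd m b S'').1]
      exact ownedSetZ_mainReading_eq_piece p s b hXd hDd rk (if_pos rfl)
    · obtain ⟨hmS, hmS''⟩ := hne_j m hm hmj
      rw [hrdl m hmj, (childReading_extra p s S Xd Dd j b S'' m).1]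
      exact ownedSetZ_extraReading_eq_piece p s b hj hjS'' hXd hDd (Finset.mem_sdiff.mpr ⟨hmS, hmS''⟩)
  have hmodel : ∀ (m : Fin 4) (hmS : m ∈ S), (m = j ∨ m ∉ S'') →
      (controlledTransform B (AffineCoordBlowup.𝓘Λ 4 K (insert 0 (Fin.succ '' (S : Set (Fin 4))))) (hypSheaf p s.F) p).comap
          (Spec.map (CommRingCat.ofHom (Θ m : A 4 K →+* A 4 K)) ≫
            AffineCoordBlowup.chartImm hB (ChartDictionary.succ_mem_centreVars hmS)) =
        hypSheaf p (if m = j then (CentreBlowup.step p S j b s).F else (escState p S m b s).F) ∧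
      (p : ℕ∞) ≤ CentreBlowup.ordAlong (if m = j then S'' else insert m (S''.erase j))
        (if m = j then (CentreBlowup.step p S j b s).F else (escState p S m b s).F) :=
    fun m hmS hmj => ⟨(hchartS m hmS hmj).2.1, (hchartS m hmS hmj).2.2⟩
  have hcompat : ∀ (m : Fin 4) (hmS : m ∈ S), (m = j ∨ m ∉ S'') → ∀ (m' : Fin 4) (hm'S : m' ∈ S), (m' = j ∨ m' ∉ S'') →
      (Spec.map (CommRingCat.ofHom (Θ m : A 4 K →+* A 4 K)) ≫
          AffineCoordBlowup.chartImm hB (ChartDictionary.succ_mem_centreVars hmS)) ''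
          (AffineCoordBlowup.CΛ 4 K (insert 0 (Fin.succ ''
            ((if m = j then S'' else insert m (S''.erase j) : Finset (Fin 4)) : Set (Fin 4)))) : Set (P 4 K)) ∩
        Set.range (AffineCoordBlowup.chartImm hB (ChartDictionary.succ_mem_centreVars hm'S)) ⊆
      (Spec.map (CommRingCat.ofHom (Θ m' : A 4 K →+* A 4 K)) ≫
          AffineCoordBlowup.chartImm hB (ChartDictionary.succ_mem_centreVars hm'S)) ''
          (AffineCoordBlowup.CΛ 4 K (insert 0 (Fin.succ ''
            ((if m' = j then S'' else insert m' (S''.erase j) : Finset (Fin 4)) : Set (Fin 4)))) : Set (P 4 K)) := by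
    rintro m hmS hmj m' hm'S hm'j z ⟨⟨y, hy, rfl⟩, hzm'⟩
    have hm : m ∈ Pc := hPc_of m hmS hmj
    have hm' : m' ∈ Pc := hPc_of m' hm'S hm'j
    have hz : (Spec.map (CommRingCat.ofHom (Θ m : A 4 K →+* A 4 K)) ≫
        AffineCoordBlowup.chartImm hB (ChartDictionary.succ_mem_centreVars (hPc m hm))) y ∈ (Zm.support : Set Bl) :=
      hmemZ m hm y (by rw [hT m]; exact hy)
    have hzr : (Spec.map (CommRingCat.ofHom (Θ m : A 4 K →+* A 4 K)) ≫
        AffineCoordBlowup.chartImm hB (ChartDictionary.succ_mem_centreVars (hPc m hm))) y ∈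
        Set.range (Spec.map (CommRingCat.ofHom (Θ m' : A 4 K →+* A 4 K)) ≫
          AffineCoordBlowup.chartImm hB (ChartDictionary.succ_mem_centreVars (hPc m' hm'))) := by
      rw [ChartDictionary.range_specMap_comp_chartImm hB _ (Θ m')]; exact hzm'
    obtain ⟨y', hy', hyz⟩ := hZ m' hm' ⟨hz, hzr⟩
    exact ⟨y', by rw [← hT m']; exact hy', hyz⟩
  have hbaseS : ∀ z ∈ (Zm.support : Set Bl), B z ∈ {x : P 4 K |
      x ∈ (AffineCoordBlowup.CΛ 4 K (insert 0 (Fin.succ '' (S : Set (Fin 4)))) : Set (P 4 K)) ∧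
        ∀ i ∈ S'' \ S, (X i.succ - C (b i) : A 4 K) ∈ x.asIdeal} := fun z hz =>
    apply_mem_base_of_cover_readings' hB Pc hPc Θ hΘall hbP (fun m => (rd m).2.1) hTm (S'' \ S) hDS
      (Zm.support : Set Bl) hcov' hZ hz
  have hoverS : (c'' : Set W) ⊆ π ⁻¹' (φ '' (ψ ⁻¹' ownedSetZ S ((S'' \ S).image fun m => (m, b m)))) := by
    intro w hw
    have hwV : w ∈ π ⁻¹ᵁ φ.opensRange := hcV hw
    have hz := (hmemε w hwV).mp hw
    have hφι : ∀ q : Y, φ.opensRange.ι (φ.isoOpensRange.hom q) = φ q := fun q => by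
      rw [← Scheme.Hom.comp_apply, Scheme.Hom.isoOpensRange_hom_ι]
    have hψι : ∀ q : Y, ψ.opensRange.ι (ψ.isoOpensRange.hom q) = ψ q := fun q => by
      rw [← Scheme.Hom.comp_apply, Scheme.Hom.isoOpensRange_hom_ι]
    obtain ⟨y, hy⟩ : ∃ y : Y, y = φ.isoOpensRange.inv ((π ∣_ φ.opensRange) ⟨w, hwV⟩) := ⟨_, rfl⟩
    have hy1 : φ.isoOpensRange.hom y = (π ∣_ φ.opensRange) ⟨w, hwV⟩ := by
      rw [hy, ← Scheme.Hom.comp_apply, Iso.inv_hom_id]; rfl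
    have hy2 : ψ.isoOpensRange.hom y = (B ∣_ ψ.opensRange) (ε.hom ⟨w, hwV⟩) := by
      rw [hy, ← Scheme.Hom.comp_apply, ← Scheme.Hom.comp_apply, ← hsq, Scheme.Hom.comp_apply]
    have hφy : φ y = π w := by
      rw [← hφι, hy1, Scheme.Opens.ι_apply, morphismRestrict_base_coe]
    have hψy : ψ y = B ((B ⁻¹ᵁ ψ.opensRange).ι (ε.hom ⟨w, hwV⟩)) := by
      rw [← hψι, hy2, Scheme.Opens.ι_apply, morphismRestrict_base_coe, Scheme.Opens.ι_apply]
    refine ⟨y, ?_, hφy⟩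
    rw [Set.mem_preimage, hψy, ownedSetZ_image_eq]
    exact hbaseS _ hz
  refine ⟨c'', Θ, hΘall, hΘ0all, hmodel, fun w hwV => ?_, hcompat, hoverS, hne, hreg, hsnc, ?_⟩
  · rw [hmemε w hwV]
    constructor
    · intro hz
      obtain ⟨m, hm, hzm⟩ := Set.mem_iUnion₂.mp (hcov' hz)
      obtain ⟨y, hy, hyz⟩ := hZ m hm ⟨hz, hzm⟩
      refine ⟨m, hPc m hm, ?_, y, ?_, hyz⟩
      · by_cases hmj : m = j
        · exact Or.inl hmj
        · exact Or.inr (hne_j m hm hmj).2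
      · rw [← hT m]; exact hy
    · rintro ⟨m, hmS, hmj, y, hy, hyz⟩
      have hm : m ∈ Pc := by
        rcases hmj with rfl | hmS''
        · exact Finset.mem_insert_self _ _
        · exact Finset.mem_insert_of_mem (Finset.mem_sdiff.mpr ⟨hmS, hmS''⟩)
      rw [← hyz]
      exact hmemZ m hm y (by rw [hT m]; exact hy)
  · let rdL : Fin 4 → AReadingL K := fun m => (rd m, childLetters m b (rd m).2.1 L)
    have himg : Pc.image rdL = insert (mainReading p (s, S, Xd, Dd) (j, b, S''), mainLetters (j, b, S'') L)
        ((S \ S'').image fun l => (extraReading p (s, S, Xd, Dd) (j, b, S'') l, extraLetters (j, b, S'') l L)) := by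
      rw [hPc_def, Finset.image_insert]
      have hj1 : rdL j = (mainReading p (s, S, Xd, Dd) (j, b, S''), mainLetters (j, b, S'') L) := by
        change (rd j, childLetters j b (rd j).2.1 L) = _
        rw [hT j, if_pos rfl, hrdj]; rfl
      rw [hj1]
      congr 1
      refine Finset.image_congr fun l hl => ?_
      have hlj : l ≠ j := by rintro rfl; exact hjSS (Finset.mem_coe.mp hl)
      change (rd l, childLetters l b (rd l).2.1 L) = _
      rw [hT l, if_neg hlj, hrdl l hlj]; rfl
    rw [← himg]
    refine memberAtlasZL_of_charts p (M.transform π Zc) c'' Pc rdL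
      (fun m hm m' hm' h => childReading_injOn p s b m hm m' hm' (congrArg Prod.fst h))
      (fun i => (((Spec.map (CommRingCat.ofHom (Θ i.1 : A 4 K →+* A 4 K)) ≫
        AffineCoordBlowup.chartImm hB (ChartDictionary.succ_mem_centreVars (hPc i.1 i.2))) ⁻¹ᵁ (B ⁻¹ᵁ ψ.opensRange) : Scheme.{0})))
      (fun i => ((Spec.map (CommRingCat.ofHom (Θ i.1 : A 4 K →+* A 4 K)) ≫
        AffineCoordBlowup.chartImm hB (ChartDictionary.succ_mem_centreVars (hPc i.1 i.2))) ∣_ (B ⁻¹ᵁ ψ.opensRange)) ≫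
          ε.inv ≫ (π ⁻¹ᵁ φ.opensRange).ι)
      (fun i => ((Spec.map (CommRingCat.ofHom (Θ i.1 : A 4 K →+* A 4 K)) ≫
        AffineCoordBlowup.chartImm hB (ChartDictionary.succ_mem_centreVars (hPc i.1 i.2))) ⁻¹ᵁ (B ⁻¹ᵁ ψ.opensRange)).ι)
      (fun i => ?_) ?_ ?_
    · obtain ⟨m, hm⟩ := i
      haveI := isOpenImmersion_specMap_algEquiv (Θ m)
      obtain ⟨hMr, hcr, -, hseen⟩ := hread m hm
      obtain ⟨idx₂, cst₂, hshape₂, hinj₂⟩ :=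
        letters_transform_zigzag_of_chart_mem φ ψ ε Zc hB hsq hC' (hPc m hm) (hbP m hm) (hΘall m hm) (hTm m hm)
          idx cst hshape hinj L hL
      refine ⟨inferInstance, inferInstance, hMr, hcr, hseen, fun v => ?_, idx₂, cst₂, hshape₂, hinj₂⟩
      rw [ownedSetZ_image_eq, hDir m hm]
      exact isClosed_zigzag_fibre_piece' φ ψ ε hB hsq Pc hPc Θ hΘall hbP hΘ0all (fun m => (rd m).2.1) hTm hST hPT Dd hDT hfib'
        Zm hZread hcov' hm v
    · intro w hw
      obtain ⟨m, hm, hwm⟩ := Set.mem_iUnion₂.mp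
        (zigzag_owned_pieces_cover φ ψ ε hB Pc hPc Θ hΘfix (fun m => (rd m).2.1) rk (Zm.support : Set Bl) hZ hcov'
          (c'' : Set W) hcV hmemε hw)
      refine Set.mem_iUnion.mpr ⟨⟨m, hm⟩, ?_⟩
      rw [hpiece m hm]
      exact hwm
    · rintro ⟨m, hm⟩ ⟨m', hm'⟩ hne'
      have hmm' : m ≠ m' := fun h => hne' (Subtype.ext h)
      rw [hpiece m hm, hpiece m' hm']
      exact zigzag_owned_pieces_disjoint φ ψ ε hB Pc hPc Θ hΘfix (fun m => (rd m).2.1) rk hrk hm hm' hmm'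

end AtlasChildL

end Equimultiple

end Summit.ResolutionOfSingularities.ResolutionOfSingularities.Theorems.PIDim4

end
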